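import Summits.HodgeConjecture.CorCM.DihedralOverImaginaryQuadraticDegenerate
import Summits.HodgeConjecture.CorCM.InvolutionsOutsideSubgroups
import Summits.HodgeConjecture.CorCM.GaloisDodecicSimpleCMSixfolds
import Summits.HodgeConjecture.CorCM.AbelianTwoPowerClassification
import Mathlib.GroupTheory.PGroup
import HarnessLib

/-!
# Galois CM fields containing an imaginary quadratic field: the COMPLETE classification of those all of whose simple
# CM abelian varieties are nondegenerate

COR-CM (cell `pub-hodgecm2`), binder seat b04 (gen 19), count-neutral claim GALOIS-TWICE-ODD, part IX (capstone of
parts I–VIII).  KERNEL ONLY: theorems; no definition, no named fact, no `sorry`.  `HC_CM` is neither used nor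
claimed.

**Theorem (`forall_isSimple_isNondegenerate_iff_of_quadratic`).**  Let `K` be a CM field, Galois over `ℚ`, containing
an imaginary quadratic field `k` (an intermediate field of degree `2` with a complex place), `H = Gal(K/k)`,
`m = [K : k]` — so `Gal(K/ℚ) = ⟨c⟩ × H` and `dim A = m` for the simple CM abelian varieties `A` with CM by `K`.  Then

  every SIMPLE abelian variety with complex multiplication by `K` is nondegenerate
    ⟺ `m` is prime, or `m = 1`, or `m = 4`, or (`m = 6` and `H` is non-abelian), or (`m = 8` and `H` has exponent `2`),

i.e. ⟺ `H ∈ {1, C₂, C₂ × C₂, C₄, C₂³, C_p (p an odd prime), S₃}`.  In all these cases the Hodge conjecture holds for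
every power of every such `A` (nondegenerate types, tree theorem); in EVERY other case `K` carries a simple DEGENERATE
CM abelian variety of dimension `m` with an exceptional Hodge class (`exists_simple_degenerate_of_quadratic`).

Assembly: good side — Yanai (prime), gen 13 `GaloisOctic` (`[K:ℚ] ≤ 10`), gen 14 `GaloisDodecic` (`ℤ/2 × S₃`),
gen 16 `AbelianTwoPowerClassification` (`(ℤ/2)⁴`); bad side — part III (a subgroup `V ≤ H`, `3 ≤ |V| < |H|`, with a
non-involution outside), else part VIII (`H` has exponent `2`, order `4`, prime order, or is dihedral `D_p`): exponent
`2` of rank `≥ 4` is bad by gen 16, `D_p` with `p ≥ 5` by part VII.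

## References

* [Yanai1985] H. Yanai, *On the rank of CM-type*, Nagoya Math. J. 97 (1985), §4 Theorem.
* [Dodson1984] B. Dodson, *The structure of Galois groups of CM-fields*, Trans. AMS 283 (1984), §3.1.1, §3.2.1, §3.3.1,
  §4.1, §5.
* [Gordon1999HodgeAVSurvey] B. B. Gordon, *A survey of the Hodge conjecture for abelian varieties*, Thm. 6.3–6.4, 9.2.2,
  §9.4.
* [Shimura1998] G. Shimura, *Abelian Varieties with Complex Multiplication and Modular Functions*, §6.2 Thm. 3, §8.2
  Prop. 26.
* [Kubota1965] T. Kubota, *On the field extension by complex multiplication*, Trans. AMS 118 (1965), §4 Lemma 2.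
-/

noncomputable section

open CategoryTheory CategoryTheory.Limits NumberField

namespace Summit.HodgeConjecture.CorCM.TwiceOdd

open Literature.NumberTheory.ComplexMultiplication
open Literature.AlgebraicGeometry.Motives (AbelianVariety CMType)
open Literature.AlgebraicGeometry.HodgeTheory
open Literature.AlgebraicGeometry.ComplexMultiplication (IsCMTypeRealisation isSimple_iff_isPrimitive)
open Literature.AlgebraicGeometry.Pohlmann1968
open Literature.Barriers.HodgeConjecture (divisorClassesSpan)
open Summit.HodgeConjecture.CorCM.GaloisOctic (complexConj_mul_comm complexConj_mul_self
  complexConj_not_mem_fixingSubgroup isNondegenerate_of_isPrimitive_of_finrank_le_ten)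
open Summit.HodgeConjecture.CorCM.GaloisDodecic (isNondegenerate_of_isPrimitive_of_isGalois_twelve_of_not_comm)
open Summit.HodgeConjecture.CorCM.AbelianSixteen (exists_simple_realisation_of_isPrimitive)
open Summit.HodgeConjecture.CorCM.AbelianOddPart (forall_isSimple_iff_forall_isPrimitive)

open scoped Classical

variable {K : Type} [Field K] [NumberField K] [IsCMField K]

/-! ## §1 The good side -/

/-- `Gal(K/ℚ)` has exponent `2` when `Gal(K/k)` has (`G = H ∪ cH`, `c` central with `c² = 1`), hence is commutative.
[folklore] -/
theorem forall_mul_self_eq_one_of_fixingSubgroup [IsGalois ℚ K] {H : Subgroup (K ≃ₐ[ℚ] K)}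
    (hH : ∀ g : K ≃ₐ[ℚ] K, g ∈ H ∨ (IsCMField.complexConj K).restrictScalars ℚ * g ∈ H)
    (hexp : ∀ h ∈ H, h * h = 1) :
    (∀ g : K ≃ₐ[ℚ] K, g * g = 1) ∧ ∀ g h : K ≃ₐ[ℚ] K, g * h = h * g := by
  set c : K ≃ₐ[ℚ] K := (IsCMField.complexConj K).restrictScalars ℚ with hc_def
  have hsq : ∀ g : K ≃ₐ[ℚ] K, g * g = 1 := by
    intro g
    rcases hH g with hg | hg
    · exact hexp g hg
    · have h1 := hexp _ hg
      -- `(c g)(c g) = c c g g = g g`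
      rwa [mul_assoc, ← mul_assoc g c, ← complexConj_mul_comm g, mul_assoc, ← mul_assoc, complexConj_mul_self,
        one_mul] at h1
  refine ⟨hsq, fun g h => ?_⟩
  have h1 := hsq (g * h)
  have h2 : g * h = (g * h)⁻¹ := (mul_eq_one_iff_eq_inv.1 h1)
  rw [h2, mul_inv_rev, (mul_eq_one_iff_eq_inv.1 (hsq g)).symm, (mul_eq_one_iff_eq_inv.1 (hsq h)).symm]

/-- **The good side.**  `K/ℚ` Galois CM, `k ⊆ K` imaginary quadratic, `m = [K:k]`: if `m` is prime (Yanai), or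
`m ∈ {1, 4}` (`[K:ℚ] ≤ 10`, gen 13), or `m = 6` with `Gal(K/k)` non-abelian (`ℤ/2 × S₃`, gen 14), or `m = 8` with
`Gal(K/k)` of exponent `2` (`(ℤ/2)⁴`, gen 16), then every primitive CM type of `K` is nondegenerate.
[cite: Yanai1985, §4 Theorem] [cite: Gordon1999HodgeAVSurvey, Thm. 6.3 and §9.4.3] [cite: Kubota1965, §4 Lemma 2] -/
theorem isNondegenerate_of_isPrimitive_of_quadratic_of_good [IsGalois ℚ K] (k : IntermediateField ℚ K)
    (hk : Module.finrank ℚ k = 2) (τ₀ : k →+* ℂ) (hτ₀ : ComplexEmbedding.conjugate τ₀ ≠ τ₀)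
    (hgood : (Module.finrank k K).Prime ∨ Module.finrank k K = 1 ∨ Module.finrank k K = 4 ∨
      (Module.finrank k K = 6 ∧ ∃ a ∈ k.fixingSubgroup, ∃ b ∈ k.fixingSubgroup, a * b ≠ b * a) ∨
      (Module.finrank k K = 8 ∧ ∀ h ∈ k.fixingSubgroup, h * h = 1))
    {Φ : CMType K} (φ₀ : K →+* ℂ) (hprim : IsPrimitive (ℂ ≃+* ℂ) Φ.1 φ₀) : IsNondegenerate Φ := by
  have hKk : Module.finrank ℚ K = 2 * Module.finrank k K := by
    rw [← Module.finrank_mul_finrank ℚ k K, hk]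
  rcases hgood with hp | h1 | h4 | ⟨h6, a, ha, b, hb, hab⟩ | ⟨h8, hexp⟩
  · exact isNondegenerate_of_isPrimitive_of_prime hp hKk φ₀ hprim
  · exact isNondegenerate_of_isPrimitive_of_finrank_le_ten (by rw [hKk, h1]; norm_num) (fun _ => inferInstance)
      φ₀ hprim
  · exact isNondegenerate_of_isPrimitive_of_finrank_le_ten (by rw [hKk, h4]; norm_num) (fun _ => inferInstance)
      φ₀ hprim
  · exact isNondegenerate_of_isPrimitive_of_isGalois_twelve_of_not_comm (by rw [hKk, h6]) ⟨a, b, hab⟩ φ₀ hprim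
  · obtain ⟨-, hH⟩ := mem_or_complexConj_mul_mem_of_quadratic k hk τ₀ hτ₀
    obtain ⟨hsq, hcomm⟩ := forall_mul_self_eq_one_of_fixingSubgroup hH hexp
    have hK16 : Module.finrank ℚ K = 2 ^ (3 + 1) := by rw [hKk, h8]; norm_num
    exact (AbelianTwoPowerClassification.forall_isPrimitive_isNondegenerate_iff hcomm hK16 φ₀).2
      (Or.inr (Or.inr ⟨by rw [hKk, h8], fun g => Or.inl (hsq g)⟩)) Φ hprim

/-! ## §2 The classification -/

/-- **THE CLASSIFICATION (primitive types).**  `K/ℚ` Galois CM with an imaginary quadratic subfield `k`, `H = Gal(K/k)`,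
`m = [K : k]`: every primitive CM type of `K` is nondegenerate **iff** `m` is prime ∨ `m = 1` ∨ `m = 4` ∨ (`m = 6` ∧ `H`
non-abelian) ∨ (`m = 8` ∧ `H` of exponent `2`) — i.e. iff `H ∈ {1, C₂, C₂², C₄, C₂³, C_p, S₃}`.
[cite: Yanai1985, §4 Theorem] [cite: Dodson1984, §3.1.1, §3.2.1 and §4.1] [cite: Gordon1999HodgeAVSurvey, §9.4.3]
[cite: Shimura1998, §8.2 Prop. 26] -/
theorem forall_isPrimitive_isNondegenerate_iff_of_quadratic [IsGalois ℚ K] (k : IntermediateField ℚ K)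
    (hk : Module.finrank ℚ k = 2) (τ₀ : k →+* ℂ) (hτ₀ : ComplexEmbedding.conjugate τ₀ ≠ τ₀) (φ₀ : K →+* ℂ) :
    (∀ Φ : CMType K, IsPrimitive (ℂ ≃+* ℂ) Φ.1 φ₀ → IsNondegenerate Φ) ↔
      ((Module.finrank k K).Prime ∨ Module.finrank k K = 1 ∨ Module.finrank k K = 4 ∨
        (Module.finrank k K = 6 ∧ ∃ a ∈ k.fixingSubgroup, ∃ b ∈ k.fixingSubgroup, a * b ≠ b * a) ∨
        (Module.finrank k K = 8 ∧ ∀ h ∈ k.fixingSubgroup, h * h = 1)) := by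
  refine ⟨fun hall => ?_, fun hgood Φ hprim => isNondegenerate_of_isPrimitive_of_quadratic_of_good k hk τ₀ hτ₀ hgood φ₀ hprim⟩
  set c : K ≃ₐ[ℚ] K := (IsCMField.complexConj K).restrictScalars ℚ with hc_def
  set H : Subgroup (K ≃ₐ[ℚ] K) := k.fixingSubgroup with hH_def
  obtain ⟨hcH, hH⟩ := mem_or_complexConj_mul_mem_of_quadratic k hk τ₀ hτ₀
  have hHcard : Nat.card H = Module.finrank k K := IsGalois.card_fixingSubgroup_eq_finrank k
  have hKk : Module.finrank ℚ K = 2 * Module.finrank k K := by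
    rw [← Module.finrank_mul_finrank ℚ k K, hk]
  have hG : Nat.card (K ≃ₐ[ℚ] K) = 2 * Module.finrank k K := by rw [IsGalois.card_aut_eq_finrank, hKk]
  by_contra hbad
  -- no primitive degenerate type exists
  have hnone : ∀ Φ : CMType K, IsPrimitive (ℂ ≃+* ℂ) Φ.1 φ₀ → ¬ IsNondegenerate Φ → False :=
    fun Φ hprim hdeg => hdeg (hall Φ hprim)
  -- Case 1: a subgroup `V ≤ H`, `3 ≤ |V| < |H|`, with a non-involution outside
  by_cases hV : ∃ V : Subgroup (K ≃ₐ[ℚ] K), V ≤ H ∧ 3 ≤ Nat.card V ∧ V ≠ H ∧ ∃ y ∈ H, y ∉ V ∧ y * y ≠ 1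
  · obtain ⟨V, hVH, h3, -, y₀, hy₀H, hy₀V, hy₀2⟩ := hV
    obtain ⟨Φ, hprim, hdeg⟩ :=
      exists_isPrimitive_not_isNondegenerate_of_quadratic k hk τ₀ hτ₀ V hVH h3 hy₀H hy₀V hy₀2 φ₀
    exact hnone Φ hprim hdeg
  -- Case 2: the structure theorem
  have hyp : ∀ V : Subgroup (K ≃ₐ[ℚ] K), V ≤ H → 3 ≤ Nat.card V → V ≠ H → ∀ y ∈ H, y ∉ V → y * y = 1 := by
    intro V hVH h3 hne y hy hyV
    by_contra hyy
    exact hV ⟨V, hVH, h3, hne, y, hy, hyV, hyy⟩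
  rcases dihedral_or_of_forall_mul_self_eq_one hyp with hexp | h4 | hprime | ⟨r, hr, s, hs, p, hp, hp3, hord, hsR, hss, hsrs, h2p⟩
  · -- (A) exponent `2`: `G` elementary abelian of order `2^{j+1}`; gen 16
    obtain ⟨hsq, hcomm⟩ := forall_mul_self_eq_one_of_fixingSubgroup hH hexp
    haveI : Fact (Nat.Prime 2) := ⟨Nat.prime_two⟩
    have hPG : IsPGroup 2 (K ≃ₐ[ℚ] K) := fun g => ⟨1, by rw [pow_one, pow_two, hsq]⟩
    obtain ⟨j, hj⟩ := IsPGroup.iff_card.1 hPG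
    have hj1 : 1 ≤ j := by
      by_contra h0
      have : j = 0 := by omega
      rw [this, pow_zero] at hj
      have := Module.finrank_pos (R := k) (M := K)
      omega
    have hK2 : Module.finrank ℚ K = 2 ^ (j - 1 + 1) := by
      rw [Nat.sub_add_cancel hj1, ← hj, IsGalois.card_aut_eq_finrank]
    rcases (AbelianTwoPowerClassification.forall_isPrimitive_isNondegenerate_iff hcomm hK2 φ₀).1 hall with
      ⟨z, hcz, hidx⟩ | hle8 | ⟨h16, -⟩
    · -- thin: `⟨z⟩` has order `≤ 2`, index `≤ 2` ⟹ `m ≤ 2`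
      have hz : Nat.card (Subgroup.zpowers z) ≤ 2 := by
        rw [Nat.card_zpowers]
        exact Nat.le_of_dvd (by norm_num) (orderOf_dvd_of_pow_eq_one (by rw [pow_two, hsq]))
      have h1 := (Subgroup.zpowers z).index_mul_card
      rw [hG] at h1
      have : 2 * Module.finrank k K ≤ 2 * 2 := by
        rw [← h1]; exact Nat.mul_le_mul hidx hz
      have hm : Module.finrank k K ≤ 2 := by omega
      have hmpos : 0 < Module.finrank k K := Module.finrank_pos
      apply hbad
      rcases (show Module.finrank k K = 1 ∨ Module.finrank k K = 2 by omega) with h | h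
      · exact Or.inr (Or.inl h)
      · exact Or.inl (h ▸ Nat.prime_two)
    · -- `[K:ℚ] ≤ 8`: `m ∈ {1, 2, 4}` (a power of `2`)
      apply hbad
      have hm4 : Module.finrank k K ≤ 4 := by omega
      have hpow : 2 * Module.finrank k K = 2 ^ j := by rw [← hG, hj]
      -- `m ∣ 2^j` with `m ≤ 4`, so `m ∈ {1,2,4}` (`3 ∤ 2^j`)
      have hm3 : Module.finrank k K ≠ 3 := by
        intro h3
        rw [h3] at hpow
        have h32 : 3 ∣ 2 ^ j := ⟨2, by omega⟩
        have := Nat.le_of_dvd (by norm_num) (Nat.Prime.dvd_of_dvd_pow Nat.prime_three h32)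
        omega
      have hmpos : 0 < Module.finrank k K := Module.finrank_pos
      rcases (show Module.finrank k K = 1 ∨ Module.finrank k K = 2 ∨ Module.finrank k K = 4 by omega) with h | h | h
      · exact Or.inr (Or.inl h)
      · exact Or.inl (h ▸ Nat.prime_two)
      · exact Or.inr (Or.inr (Or.inl h))
    · -- `[K:ℚ] = 16`: `m = 8` with exponent `2`
      exact hbad (Or.inr (Or.inr (Or.inr (Or.inr ⟨by omega, hexp⟩))))
  · -- (B) `|H| = 4`
    exact hbad (Or.inr (Or.inr (Or.inl (hHcard ▸ h4))))
  · -- (C) `|H|` prime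
    exact hbad (Or.inl (hHcard ▸ hprime))
  · -- (D) dihedral of order `2p`
    by_cases hp3' : p = 3
    · -- `ℤ/2 × S₃`: good by gen 14 — so GOOD holds
      subst hp3'
      apply hbad
      refine Or.inr (Or.inr (Or.inr (Or.inl ⟨by rw [← hHcard, h2p], r, hr, s, hs, fun hcomm => ?_⟩)))
      -- `s r s⁻¹ = r⁻¹ ≠ r`
      have hr2 : r⁻¹ ≠ r := by
        intro h
        have h2 : r * r = 1 := by
          calc r * r = r⁻¹ * r := by rw [h]
            _ = 1 := inv_mul_cancel r
        have := Nat.le_of_dvd (by norm_num) (orderOf_dvd_of_pow_eq_one (show r ^ 2 = 1 by rw [pow_two, h2]))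
        rw [hord] at this
        omega
      apply hr2
      calc r⁻¹ = s * r * s⁻¹ := hsrs.symm
        _ = r * s * s⁻¹ := by rw [← hcomm]
        _ = r := by rw [mul_assoc, mul_inv_cancel, mul_one]
    · have h5 : 5 ≤ p := by
        by_contra hlt
        have hp4 : p = 4 := by omega
        rw [hp4] at hp
        exact absurd hp (by decide)
      obtain ⟨Φ, hprim, hdeg⟩ := exists_isPrimitive_not_isNondegenerate_of_dihedral k hk τ₀ hτ₀ hp h5
        (by rw [← hHcard, h2p]) hr hs hord hsR hss hsrs φ₀
      exact hnone Φ hprim hdeg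

/-- **THE CLASSIFICATION (simple abelian varieties).**  `K/ℚ` Galois CM with an imaginary quadratic subfield `k`,
`m = [K : k]`: every SIMPLE abelian variety with complex multiplication by `K` is nondegenerate — Hodge conjecture for all
its powers — **iff** `Gal(K/k) ∈ {1, C₂, C₂², C₄, C₂³, C_p (p odd prime), S₃}`, i.e. iff `m` prime ∨ `m = 1` ∨
`m = 4` ∨ (`m = 6`, `Gal(K/k)` non-abelian) ∨ (`m = 8`, `Gal(K/k)` of exponent `2`).
[cite: Yanai1985, §4 Theorem] [cite: Dodson1984, §3.1.1, §3.2.1 and §4.1] [cite: Shimura1998, §6.2 Thm. 3 and §8.2 Prop. 26]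
[cite: Gordon1999HodgeAVSurvey, Thm. 6.4 and §9.4.3] -/
theorem forall_isSimple_isNondegenerate_iff_of_quadratic [IsGalois ℚ K] (k : IntermediateField ℚ K)
    (hk : Module.finrank ℚ k = 2) (τ₀ : k →+* ℂ) (hτ₀ : ComplexEmbedding.conjugate τ₀ ≠ τ₀) :
    (∀ (Φ : CMType K) (A : AbelianVariety ℂ) (ι : 𝓞 K →+* End A) (θ : K →+* Module.End ℂ (complexBetti A.X 1)),
        IsCMTypeRealisation Φ A ι θ → A.IsSimple → IsNondegenerate Φ) ↔
      ((Module.finrank k K).Prime ∨ Module.finrank k K = 1 ∨ Module.finrank k K = 4 ∨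
        (Module.finrank k K = 6 ∧ ∃ a ∈ k.fixingSubgroup, ∃ b ∈ k.fixingSubgroup, a * b ≠ b * a) ∨
        (Module.finrank k K = 8 ∧ ∀ h ∈ k.fixingSubgroup, h * h = 1)) := by
  obtain ⟨φ₀⟩ := (inferInstance : Nonempty (K →+* ℂ))
  rw [forall_isSimple_iff_forall_isPrimitive φ₀]
  exact forall_isPrimitive_isNondegenerate_iff_of_quadratic k hk τ₀ hτ₀ φ₀

variable {Φ : CMType K} {A : AbelianVariety ℂ} {ι : 𝓞 K →+* End A} {θ : K →+* Module.End ℂ (complexBetti A.X 1)}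

/-- **Good side: the Hodge conjecture for every power of every simple abelian variety with CM by `K`** when
`Gal(K/k) ∈ {1, C₂, C₂², C₄, C₂³, C_p, S₃}`, unconditionally. [cite: Gordon1999HodgeAVSurvey, Thm. 6.3–6.4]
[cite: Yanai1985, Remark (p. 172)] -/
theorem hodgeConjectureFor_pow_of_isSimple_of_quadratic_of_good [IsGalois ℚ K] (k : IntermediateField ℚ K)
    (hk : Module.finrank ℚ k = 2) (τ₀ : k →+* ℂ) (hτ₀ : ComplexEmbedding.conjugate τ₀ ≠ τ₀)
    (hgood : (Module.finrank k K).Prime ∨ Module.finrank k K = 1 ∨ Module.finrank k K = 4 ∨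
      (Module.finrank k K = 6 ∧ ∃ a ∈ k.fixingSubgroup, ∃ b ∈ k.fixingSubgroup, a * b ≠ b * a) ∨
      (Module.finrank k K = 8 ∧ ∀ h ∈ k.fixingSubgroup, h * h = 1))
    (hA : IsCMTypeRealisation Φ A ι θ) (hs : A.IsSimple) (N : ℕ) :
    HodgeConjectureFor (⨁ fun _ : Fin N => A).dim (⨁ fun _ : Fin N => A).X := by
  obtain ⟨φ₀⟩ := (inferInstance : Nonempty (K →+* ℂ))
  exact (isNondegenerate_of_isPrimitive_of_quadratic_of_good k hk τ₀ hτ₀ hgood φ₀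
    ((isSimple_iff_isPrimitive hA φ₀).1 hs)).hodgeConjectureFor_pow hA N

/-- **Bad side: in every other case a SIMPLE DEGENERATE CM abelian variety of dimension `[K:k]` with CM by `K`
exists**, with an exceptional Hodge class on some power. [cite: Dodson1984, §3.2.1 and §4.1]
[cite: Shimura1998, §6.2 Thm. 3 and §8.2 Prop. 26] [cite: Gordon1999HodgeAVSurvey, Thm. 6.4] -/
theorem exists_simple_degenerate_of_quadratic [IsGalois ℚ K] (k : IntermediateField ℚ K)
    (hk : Module.finrank ℚ k = 2) (τ₀ : k →+* ℂ) (hτ₀ : ComplexEmbedding.conjugate τ₀ ≠ τ₀)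
    (hbad : ¬ ((Module.finrank k K).Prime ∨ Module.finrank k K = 1 ∨ Module.finrank k K = 4 ∨
      (Module.finrank k K = 6 ∧ ∃ a ∈ k.fixingSubgroup, ∃ b ∈ k.fixingSubgroup, a * b ≠ b * a) ∨
      (Module.finrank k K = 8 ∧ ∀ h ∈ k.fixingSubgroup, h * h = 1))) :
    ∃ (Φ : CMType K) (φ₀ : K →+* ℂ) (A : AbelianVariety ℂ) (ι : 𝓞 K →+* End A)
      (θ : K →+* Module.End ℂ (complexBetti A.X 1)),
      IsPrimitive (ℂ ≃+* ℂ) Φ.1 φ₀ ∧ ¬ IsNondegenerate Φ ∧ IsCMTypeRealisation Φ A ι θ ∧ A.IsSimple ∧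
      A.dim = Module.finrank k K ∧
      ∃ n p : ℕ, ∃ x : complexBetti (⨁ fun _ : Fin n => A).X (2 * p), IsRationalClass x ∧
        IsOfHodgeType (⨁ fun _ : Fin n => A).dim (⨁ fun _ : Fin n => A).X (2 * p) p p x ∧
        x ∉ divisorClassesSpan (⨁ fun _ : Fin n => A).X (⨁ fun _ : Fin n => A).dim p := by
  obtain ⟨φ₀⟩ := (inferInstance : Nonempty (K →+* ℂ))
  have h := (forall_isPrimitive_isNondegenerate_iff_of_quadratic k hk τ₀ hτ₀ φ₀).not.2 hbad
  push Not at h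
  obtain ⟨Φ, hprim, hdeg⟩ := h
  obtain ⟨A, ι, θ, hA, hs, hdim⟩ := exists_simple_realisation_of_isPrimitive Φ φ₀ hprim
  have hKk : Module.finrank ℚ K / 2 = Module.finrank k K := by
    have h := Module.finrank_mul_finrank ℚ k K
    rw [hk] at h
    omega
  exact ⟨Φ, φ₀, A, ι, θ, hprim, hdeg, hA, hs, hdim.trans hKk,
    exists_exceptional_pow_of_not_isNondegenerate φ₀ hprim hdeg hA⟩

end Summit.HodgeConjecture.CorCM.TwiceOdd

end
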